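import Summits.Ventures.Crystal3D.Theorems.StickyWulffConstantGenericWallFloorTubeLemma
import Mathlib.Analysis.InnerProductSpace.PiL2
import Summits.Ventures.Crystal3D.Theorems.StickyWulffConstantGenericWallFloorConeCertificateDefs
import HarnessLib

/-!
# Cone certificates (2/3): frame lemmas in `ℝ³` and the sharper ε-tube lemma (radius `3κ/5`)

Helper for `stmt-Ventures-19480` (E1).  Tools for the bridge `ConeCert.margin` (file 3/3):
three pairwise orthogonal nonzero vectors exhaust `ℝ³` (`eq_zero_of_orthogonal_three`), the Parseval
identity in an orthogonal (not normalised) frame (`frame_parseval`) and its consequence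
`exists_dir_of_frame` (a vector in the plane `⟂ S` has a signed frame direction `±T_a` with
`⟨w, ±T_a⟩ ≥ ‖w‖ ‖T_a‖ / √2`), the averaging lemma `exists_le_of_sum_eq`, and
`eq_of_coneMargin_sharp`: the landed `eq_of_coneMargin` (p572943) with tube radius `3κ/5` instead of
`κ/3` when `κ ≤ 1`.

lit g11 (crystal3d-full; HOME/cf-lit/lean/conecert/, evidence #55 on stmt-Ventures-19480), landed verbatim
(split in three files for the 400-line rule) by prover 19480-p2.  Data: `…ConeCertData*.lean` (kit j291074/j291568,
`cert/gencert.py`): every own-pattern orbit with `|O| ≥ 6` (fcc and hcp) except the two flexible ones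
(C12-924, A12-603), and the P₅ capper pattern, each with one `decide`.
-/

noncomputable section

namespace Summit.Ventures.Crystal3D.Theorems

open Finset Literature.Geometry.DiscreteGeometry
open scoped RealInnerProductSpace


/-! ### Three pairwise orthogonal nonzero vectors exhaust `ℝ³` -/

/-- In `ℝ³`, a vector orthogonal to three pairwise orthogonal nonzero vectors is zero. -/
theorem eq_zero_of_orthogonal_three {a b c w : (EuclideanSpace ℝ (Fin 3))} (ha : a ≠ 0) (hb : b ≠ 0) (hc : c ≠ 0)
    (hab : ⟪a, b⟫ = 0) (hac : ⟪a, c⟫ = 0) (hbc : ⟪b, c⟫ = 0)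
    (hwa : ⟪w, a⟫ = 0) (hwb : ⟪w, b⟫ = 0) (hwc : ⟪w, c⟫ = 0) : w = 0 := by
  by_contra hw
  let f : Fin 4 → (EuclideanSpace ℝ (Fin 3)) := ![a, b, c, w]
  have hne : ∀ i, f i ≠ 0 := by
    intro i; fin_cases i <;> simp [f] <;> assumption
  have hba : ⟪b, a⟫ = 0 := by rw [real_inner_comm]; exact hab
  have hca : ⟪c, a⟫ = 0 := by rw [real_inner_comm]; exact hac
  have hcb : ⟪c, b⟫ = 0 := by rw [real_inner_comm]; exact hbc
  have haw : ⟪a, w⟫ = 0 := by rw [real_inner_comm]; exact hwa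
  have hbw : ⟪b, w⟫ = 0 := by rw [real_inner_comm]; exact hwb
  have hcw : ⟪c, w⟫ = 0 := by rw [real_inner_comm]; exact hwc
  have horth : Pairwise fun i j => ⟪f i, f j⟫ = 0 := by
    intro i j hij
    fin_cases i <;> fin_cases j <;> first | exact absurd rfl hij | (simp [f]; assumption)
  have hli : LinearIndependent ℝ f := linearIndependent_of_ne_zero_of_inner_eq_zero hne horth
  have h4 := hli.fintype_card_le_finrank
  rw [finrank_euclideanSpace_fin] at h4
  simp at h4

/-! ### A sharper tube radius: `3κ/5` instead of `κ/3` (for `κ ≤ 1`)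

Same argument as the landed `eq_of_coneMargin`, using the exact norm of the tangent part
`‖v i₀‖² = ε² − ε⁴/4` instead of `‖v i₀‖ ≥ ε/2`: from `κ ‖v i₀‖ ≤ (3/2) ε²` and `ε < 3κ/5 ≤ 3/5` one gets
`κ² (1 − ε²/4) ≤ (9/4) ε² < (81/100) κ²` while `1 − ε²/4 ≥ 91/100` — impossible unless `ε = 0`.  (This
multiplies the admissible tube radius of every E1 row by `9/5`, i.e. the slack the outside B&B must
resolve near the exact completion by `≈ 3`.) -/

/-- **The ε-tube lemma with radius `3κ/5`** (hypotheses as in `eq_of_coneMargin`, plus `κ ≤ 1`). -/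
theorem eq_of_coneMargin_sharp {E : Type*} [NormedAddCommGroup E] [InnerProductSpace ℝ E]
    {ι : Type*} [Fintype ι] {s x : ι → E} {O : Finset E} {κ : ℝ}
    (hκ : 0 < κ) (hκ1 : κ ≤ 1)
    (hs : ∀ i, ‖s i‖ = 1) (hx : ∀ i, ‖x i‖ = 1)
    (hxo : ∀ i, ∀ o ∈ O, ⟪s i, o⟫ = 1 / 2 → ⟪x i, o⟫ ≤ 1 / 2)
    (hxx : ∀ i j, i ≠ j → ⟪s i, s j⟫ = 1 / 2 → ⟪x i, x j⟫ ≤ 1 / 2)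
    (hmargin : ∀ v : ι → E, (∀ i, ⟪v i, s i⟫ = 0) → ∀ i₀ : ι,
      (∃ i, ∃ o ∈ O, ⟪s i, o⟫ = 1 / 2 ∧ κ * ‖v i₀‖ ≤ ⟪v i, o⟫) ∨
      (∃ i j, i ≠ j ∧ ⟪s i, s j⟫ = 1 / 2 ∧ κ * ‖v i₀‖ ≤ ⟪v i, s j⟫ + ⟪s i, v j⟫))
    (hclose : ∀ i, ‖x i - s i‖ < 3 * κ / 5) : x = s := by
  classical
  rcases isEmpty_or_nonempty ι with hι | hι
  · funext i; exact (hι.false i).elim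
  set v : ι → E := fun i => (x i - s i) + (‖x i - s i‖ ^ 2 / 2) • s i with hv
  have hvt : ∀ i, ⟪v i, s i⟫ = 0 := fun i => inner_tangentPart_eq_zero (hs i) (hx i)
  obtain ⟨i₀, hi₀⟩ := Finite.exists_max fun i => ‖x i - s i‖
  set ε := ‖x i₀ - s i₀‖ with hεdef
  have hε0 : 0 ≤ ε := norm_nonneg _
  have hεi : ∀ i, ‖x i - s i‖ ≤ ε := hi₀
  have hεκ : ε < 3 * κ / 5 := hclose i₀
  have hε35 : ε ≤ 3 / 5 := by linarith
  -- exact norm of the tangent part at i₀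
  have hvsq : ‖v i₀‖ ^ 2 = ε ^ 2 - ε ^ 4 / 4 := norm_tangentPart_sq (hs i₀) (hx i₀)
  -- upper bound on every active linearised constraint (verbatim from `eq_of_coneMargin`)
  have hup : κ * ‖v i₀‖ ≤ 3 / 2 * ε ^ 2 := by
    rcases hmargin v hvt i₀ with ⟨i, o, ho, hso, hle⟩ | ⟨i, j, hij, hss, hle⟩
    · have h1 : ⟪v i, o⟫ ≤ ‖x i - s i‖ ^ 2 / 4 := inner_tangentPart_own_le hso (hxo i o ho hso)
      have h2 : ‖x i - s i‖ ^ 2 ≤ ε ^ 2 := pow_le_pow_left₀ (norm_nonneg _) (hεi i) 2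
      nlinarith
    · have h1 : ⟪v i, s j⟫ + ⟪s i, v j⟫ ≤
          ‖x i - s i‖ * ‖x j - s j‖ + (‖x i - s i‖ ^ 2 + ‖x j - s j‖ ^ 2) / 4 :=
        inner_tangentPart_free_le hss (hxx i j hij hss)
      have h2 : ‖x i - s i‖ ^ 2 ≤ ε ^ 2 := pow_le_pow_left₀ (norm_nonneg _) (hεi i) 2
      have h3 : ‖x j - s j‖ ^ 2 ≤ ε ^ 2 := pow_le_pow_left₀ (norm_nonneg _) (hεi j) 2
      have h4 : ‖x i - s i‖ * ‖x j - s j‖ ≤ ε * ε :=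
        mul_le_mul (hεi i) (hεi j) (norm_nonneg _) hε0
      nlinarith
  -- conclude ε = 0
  have hεz : ε = 0 := by
    by_contra hne
    have hpos : 0 < ε := lt_of_le_of_ne hε0 (Ne.symm hne)
    have hv0 : 0 ≤ ‖v i₀‖ := norm_nonneg _
    -- square the inequality κ ‖v‖ ≤ (3/2) ε²
    have hsq : κ ^ 2 * (ε ^ 2 - ε ^ 4 / 4) ≤ (3 / 2 * ε ^ 2) ^ 2 := by
      rw [← hvsq, ← mul_pow]
      exact pow_le_pow_left₀ (by positivity) hup 2
    -- divide by ε² > 0:  κ² (1 − ε²/4) ≤ (9/4) ε²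
    have hε2 : 0 < ε ^ 2 := by positivity
    have hA : κ ^ 2 * (1 - ε ^ 2 / 4) ≤ 9 / 4 * ε ^ 2 := by
      have : ε ^ 2 * (κ ^ 2 * (1 - ε ^ 2 / 4)) ≤ ε ^ 2 * (9 / 4 * ε ^ 2) := by nlinarith
      exact le_of_mul_le_mul_left this hε2
    -- but ε < 3κ/5 and ε ≤ 3/5
    have hB : 9 / 4 * ε ^ 2 < 81 / 100 * κ ^ 2 := by nlinarith
    have hε2le : ε ^ 2 ≤ 9 / 25 := by nlinarith
    have hC : 91 / 100 * κ ^ 2 ≤ κ ^ 2 * (1 - ε ^ 2 / 4) := by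
      have : 0 ≤ κ ^ 2 * (9 / 25 - ε ^ 2) := mul_nonneg (sq_nonneg κ) (by linarith)
      nlinarith
    have hκ2 : 0 < κ ^ 2 := by positivity
    linarith
  funext i
  have : ‖x i - s i‖ ≤ 0 := by rw [← hεz]; exact hεi i
  have h0 : x i - s i = 0 := norm_le_zero_iff.1 this
  exact sub_eq_zero.1 h0

/-! ### The bridge -/

/-- Averaging: a nonnegative combination with total weight `Λ > 0` equal to `y` has a term `≥ y/Λ`. -/
theorem exists_le_of_sum_eq {α : Type*} (S : Finset α) (lam x : α → ℝ) {Λ y : ℝ}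
    (hlam : ∀ c ∈ S, 0 ≤ lam c) (hΛ : ∑ c ∈ S, lam c = Λ) (hΛ0 : 0 < Λ)
    (hy : ∑ c ∈ S, lam c * x c = y) : ∃ c ∈ S, y / Λ ≤ x c := by
  by_contra h
  simp only [not_exists, not_and, not_le] at h
  have hne : S.Nonempty := by
    by_contra he
    rw [Finset.not_nonempty_iff_eq_empty] at he
    rw [he, Finset.sum_empty] at hΛ; linarith
  have : ∑ c ∈ S, lam c * x c ≤ ∑ c ∈ S, lam c * (y / Λ) :=
    Finset.sum_le_sum fun c hc => mul_le_mul_of_nonneg_left (h c hc).le (hlam c hc)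
  rw [hy, ← Finset.sum_mul, hΛ] at this
  -- y ≤ Λ * (y/Λ) = y is fine; need strictness from some positive weight
  obtain ⟨c₀, hc₀, hpos⟩ : ∃ c ∈ S, 0 < lam c := by
    by_contra h0
    simp only [not_exists, not_and, not_lt] at h0
    have : ∑ c ∈ S, lam c ≤ 0 := Finset.sum_nonpos h0
    linarith
  have hlt : ∑ c ∈ S, lam c * x c < ∑ c ∈ S, lam c * (y / Λ) :=
    Finset.sum_lt_sum (fun c hc => mul_le_mul_of_nonneg_left (h c hc).le (hlam c hc))
      ⟨c₀, hc₀, mul_lt_mul_of_pos_left (h c₀ hc₀) hpos⟩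
  rw [hy, ← Finset.sum_mul, hΛ] at hlt
  have : Λ * (y / Λ) = y := by field_simp
  linarith

/-! ### Frame lemma in `ℝ³` -/

/-- If `Σ, T₀, T₁` are pairwise orthogonal and nonzero in `ℝ³` and `w ⊥ Σ`, then
`‖T₀‖² ‖T₁‖² ‖w‖² = ‖T₁‖² ⟪w,T₀⟫² + ‖T₀‖² ⟪w,T₁⟫²` (Parseval in the tangent plane). -/
theorem frame_parseval {S T0 T1 w : (EuclideanSpace ℝ (Fin 3))} (hS : S ≠ 0) (h0 : T0 ≠ 0) (h1 : T1 ≠ 0)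
    (hS0 : ⟪S, T0⟫ = 0) (hS1 : ⟪S, T1⟫ = 0) (h01 : ⟪T0, T1⟫ = 0) (hw : ⟪w, S⟫ = 0) :
    ‖T0‖ ^ 2 * ‖T1‖ ^ 2 * ‖w‖ ^ 2 = ‖T1‖ ^ 2 * ⟪w, T0⟫ ^ 2 + ‖T0‖ ^ 2 * ⟪w, T1⟫ ^ 2 := by
  set w' : (EuclideanSpace ℝ (Fin 3)) := (‖T0‖ ^ 2 * ‖T1‖ ^ 2) • w - (‖T1‖ ^ 2 * ⟪w, T0⟫) • T0 - (‖T0‖ ^ 2 * ⟪w, T1⟫) • T1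
    with hw'
  have h10 : ⟪T1, T0⟫ = 0 := by rw [real_inner_comm]; exact h01
  have hw'S : ⟪w', S⟫ = 0 := by
    rw [hw', inner_sub_left, inner_sub_left, real_inner_smul_left, real_inner_smul_left,
      real_inner_smul_left, hw, real_inner_comm S T0, hS0, real_inner_comm S T1, hS1]; ring
  have hw'0 : ⟪w', T0⟫ = 0 := by
    rw [hw', inner_sub_left, inner_sub_left, real_inner_smul_left, real_inner_smul_left,
      real_inner_smul_left, real_inner_self_eq_norm_sq, h10]; ring
  have hw'1 : ⟪w', T1⟫ = 0 := by
    rw [hw', inner_sub_left, inner_sub_left, real_inner_smul_left, real_inner_smul_left,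
      real_inner_smul_left, real_inner_self_eq_norm_sq, h01]; ring
  have hz : w' = 0 := eq_zero_of_orthogonal_three hS h0 h1 hS0 hS1 h01 hw'S hw'0 hw'1
  have hww : ⟪w', w⟫ = 0 := by rw [hz, inner_zero_left]
  rw [hw', inner_sub_left, inner_sub_left, real_inner_smul_left, real_inner_smul_left,
    real_inner_smul_left, real_inner_self_eq_norm_sq, real_inner_comm w T0, real_inner_comm w T1] at hww
  linear_combination hww

/-- Consequence: one of the two signed frame directions `±T a` sees at least `‖w‖ ‖T a‖/√2`. -/
theorem exists_dir_of_frame {S w : (EuclideanSpace ℝ (Fin 3))} {T : Fin 2 → (EuclideanSpace ℝ (Fin 3))} (hS : S ≠ 0) (h0 : T 0 ≠ 0) (h1 : T 1 ≠ 0)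
    (hS0 : ⟪S, T 0⟫ = 0) (hS1 : ⟪S, T 1⟫ = 0) (h01 : ⟪T 0, T 1⟫ = 0) (hw : ⟪w, S⟫ = 0) :
    ∃ a : Fin 2, ∃ b : Bool,
      ‖w‖ ^ 2 * ‖T a‖ ^ 2 ≤ 2 * ⟪w, T a⟫ ^ 2 ∧ 0 ≤ (ConeCert.sgn b : ℝ) * ⟪w, T a⟫ := by
  have hP := frame_parseval hS h0 h1 hS0 hS1 h01 hw
  have hn0 : 0 < ‖T 0‖ ^ 2 := by positivity
  have hn1 : 0 < ‖T 1‖ ^ 2 := by positivity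
  have hsign : ∀ x : ℝ, ∃ b : Bool, 0 ≤ (ConeCert.sgn b : ℝ) * x := by
    intro x
    rcases le_or_gt 0 x with h | h
    · exact ⟨true, by rw [ConeCert.sgn_true, Int.cast_one, one_mul]; exact h⟩
    · exact ⟨false, by rw [ConeCert.sgn_false, Int.cast_neg, Int.cast_one]; linarith⟩
  by_cases hcase : ‖T 0‖ ^ 2 * ⟪w, T 1⟫ ^ 2 ≤ ‖T 1‖ ^ 2 * ⟪w, T 0⟫ ^ 2
  · obtain ⟨b, hb⟩ := hsign ⟪w, T 0⟫
    refine ⟨0, b, ?_, hb⟩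
    have h2 : ‖T 1‖ ^ 2 * (‖w‖ ^ 2 * ‖T 0‖ ^ 2) ≤ ‖T 1‖ ^ 2 * (2 * ⟪w, T 0⟫ ^ 2) := by nlinarith
    exact le_of_mul_le_mul_left h2 hn1
  · obtain ⟨b, hb⟩ := hsign ⟪w, T 1⟫
    refine ⟨1, b, ?_, hb⟩
    have hcase' := (not_le.mp hcase).le
    have h2 : ‖T 0‖ ^ 2 * (‖w‖ ^ 2 * ‖T 1‖ ^ 2) ≤ ‖T 0‖ ^ 2 * (2 * ⟪w, T 1⟫ ^ 2) := by nlinarith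
    exact le_of_mul_le_mul_left h2 hn0


end Summit.Ventures.Crystal3D.Theorems

end
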